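import Summits.HodgeConjecture.HodgeConjecture.Theorems.F0P3cStCharTSLdsOpp              -- ★ (LH6-p05 g4) «LDS-OPP★»: §1 `psTrace_eq_zero_of_forall_classOrbitalIntegral_split_eq_zero`, §2 `classOrbitalIntegral_indicator_eq_zero_of_disjoint_hyperbolicSet` (the ENGINE, imported BY NAME)
import HarnessLib

/-!
# F0 · P3c · line LH6 «StCharTS» — «OPP-23★»: «`χ_σ = −χ_π` ON `G^e`» FOR THE PAIRS OF KINDS 2–3 (`{ψ∘det_G, St_G(ψ)}`, `{πⁿ(ξ), π²(ξ)}`)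
# [Rogawski1990, §12.6 p. 188 «For (c), observe that `χ_π = −χ_{π′}` on `G^e`»], DERIVED ON THE MODEL `U(Φ₃)(L⁺_v)` FROM THE PAIR SOCKET (PS2),
# HARISH-CHANDRA REGULARITY (M1∀) AND VAN DIJK'S FORMULA — THE KINDS-2–3 TWIN OF ★ `F0P3cStCharTSLdsOpp.ldsCharactersOpposite_of_PS3`

Cell `pub/hodgecm-mathlib`, crux H413 = `stmt-HodgeConjecture-24833` (`--supports` lane, helper), route HCCMUnconditional; seat F0P2-p02 (g23) on the
LEAD's word over CENSUS «R0-PRINT-RESIDUE» v1 (F0P3a-p05 (g25), 39dfcb9e16e070c5) §2-K4 (3)(5), §4 engine E5, §6.3 «label-shrinking K4 ↦ K4′».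
THEOREMS ONLY, sorry-free, no definition ∕ instance ∕ notation ∕ named fact; the §12.5 datum `𝔇` is a BINDER.  HONEST LABEL: HC_CM is proved only modulo
the 7 printed citations (2 remaining: hLiu418 = stmt-HodgeConjecture-24832, h413 = stmt-HodgeConjecture-24833) until rung 0 closes; count-neutral (no leaf
edition is implied: together with «61C-OF-NORMS★» this file lets the RUNG0 ∕ leaf pens re-letter the block conjunct `Ch12Sec6.Prop1261c 𝔇` to the l.d.s.
norm-one sentence K4′, the kinds-2–3 instances being derived).

THE MATHEMATICS (print p. 188; L. 12.7.2 proof p. 192: for the pairs `{π, σ}` of kinds 2–3 with `π` the non-square-integrable member, `χ_π + χ_σ = χ_{i_G(χ)}`).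
Let `π` be NOT square-integrable, `σ` square-integrable, `{π, σ}` a pair of one of the three kinds (★ `IsEllipticPair`), `γ ∈ G^e`.  The package gives (PS2):
`Tr π(f) + Tr σ(f) = Tr i_G(par π)(f)` for every `f ∈ C_c^∞`, with `par π` a CONTINUOUS pair ((NONL2-PAR) at the non-square-integrable `π`); (M1∀) for `π`, `σ`.
As in ★ «LDS-OPP★»: `G^e ⊆ G^r ∖ Ω` (`hEΩ`), `G^r ∖ Ω` open (`hopen`, ★ ELL-OPEN at the junction); a compact-open `U ∋ γ` inside `G^r ∖ Ω` on which `χ_π`, `χ_σ` are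
constant gives `Tr π(𝟙_U) = ν(U)·χ_π(γ)`, `Tr σ(𝟙_U) = ν(U)·χ_σ(γ)`, while `Tr i_G(par π)(𝟙_U) = 0` by van Dijk's formula against CANONICAL orbital integrals (★ LDS-OPP
§1) since the orbital integrals of `𝟙_U` vanish at the regular split classes (★ LDS-OPP §2).  `ν(U) > 0` gives `χ_π(γ) + χ_σ(γ) = 0`.

* §1 `charOpposite_of_PS2` — «`χ_σ = −χ_π` on `G^e`» for `π` non-L², `σ` L², `IsEllipticPair π σ`, from COMPAT (`μG`, `regG`), `hEΩ`, `hopen`, (M1∀), (PS2),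
  (NONL2-PAR) (texts VERBATIM from ★ `ldsCharactersOpposite_of_PS3` ∕ ★ `F0P3cStCharTSPs2Assembly.ps2_of_kinds`' conclusion with `𝔇.IsL2`); kind 1 never fires here
  (it is vacuous under (LDS), ★ `F0P3cStCharTSPs2Assembly.ps2_kind1_absurd`) — the hypothesis shape is (PS2)'s own.
* §2 `charOpposite_of_PS2'` — the same with the two members in the symmetric orientation (`char π = − char σ` on `G^e`), a one-line corollary for consumers.

## References
* [Rogawski1990] J. D. Rogawski, *Automorphic Representations of Unitary Groups in Three Variables*, Ann. of Math. Stud. 123 (1990): §12.6 Prop. 12.6.1 (c)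
  p. 188; §12.7 L. 12.7.2 (proof) p. 192; §4.9 Lemma 4.9.2 (proof) pp. 55–56; §12.5 p. 184 (`G^e`); §1.6 p. 5.
* [vanDijk1972] G. van Dijk, *Computation of certain induced characters of 𝔭-adic groups*, Math. Ann. 199 (1972), Thm. p. 237.
-/

set_option autoImplicit false
-- the mandated namespace has the single-problem summit's repeated segment (`HodgeConjecture.HodgeConjecture`)
set_option linter.dupNamespace false

noncomputable section

open NumberField IsDedekindDomain MeasureTheory MeasureTheory.Measure Filter Topology TopologicalSpace
open scoped Matrix MatrixGroups
open Literature.NumberTheory.Rogawski1990 Literature.NumberTheory.Automorphic Literature.NumberTheory.Automorphic.UnitaryGroup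

namespace Summit.HodgeConjecture.HodgeConjecture.Cruxes.H413.F0P3cStCharTSOpp23

open Literature.NumberTheory.Rogawski1990.Ch12Sec5
open Summit.HodgeConjecture.HodgeConjecture.Cruxes.H413.F0P3cStCharTSTorusDefs
open Summit.HodgeConjecture.HodgeConjecture.Cruxes.H413.F0P3cStCharTSLdsOpp

/-! ## §1 (OPP-23): `χ_σ = −χ_π` on `G^e` for a pair of kinds 2–3 -/

set_option maxHeartbeats 1600000 in
set_option synthInstance.maxHeartbeats 400000 in
/-- **«OPP-23★» — «`χ_σ = −χ_π` on `G^e`» for `π` NOT square-integrable, `σ` square-integrable and `{π, σ}` a pair of one of the three kinds (★ `IsEllipticPair`),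
on `U(Φ₃)(L⁺_v)` (`v` non-split)** at any §12.5 datum `𝔇` with: COMPAT `𝔇.μG = νQv`, `regG ↔ IsRegularElt`; the pin consequence `hEΩ : G^e ⊆ G^r ∖ Ω`; the
topological input `hopen : IsOpen (G^r ∖ Ω)` (★ ELL-OPEN); (M1∀) = Harish-Chandra regularity for EVERY class (the `hM1` binder of ★ `ldsCharactersOpposite_of_PS3`
token for token) [§1.6 p. 5]; the PAIR socket (PS2) and (NONL2-PAR) of the (S-𝔇) package VERBATIM (parameter map `par`).  Print: «observe that `χ_π = −χ_{π′}` on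
`G^e`» [p. 188], «`χ_π + χ_{π′} = χ_{i_G(χ)}`» [p. 192].  Proof: module docstring (the proof of ★ `ldsCharactersOpposite_of_PS3` with (PS3) ↦ (PS2)).
[cite: Rogawski1990, §12.6 Prop. 12.6.1 (c) p. 188; §12.7 L. 12.7.2 (proof) p. 192; §4.9 Lemma 4.9.2 (proof) pp. 55–56; §1.6 p. 5] [cite: vanDijk1972, Thm. p. 237] -/
theorem charOpposite_of_PS2
    (L : Type) [Field L] [NumberField L] [IsCMField L] (v : HeightOneSpectrum (𝓞 ↥(maximalRealSubfield L)))
    (hns : ∀ w : PlacesOver L v, IsCMField.complexConj L • w.1 = w.1)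
    [MeasurableSpace (Gqs L v)] [BorelSpace (Gqs L v)]
    [∀ γ : Gqs L v, MeasurableSpace (Gqs L v ⧸ Subgroup.centralizer ({γ} : Set (Gqs L v)))]
    [∀ γ : Gqs L v, BorelSpace (Gqs L v ⧸ Subgroup.centralizer ({γ} : Set (Gqs L v)))]
    [MeasurableSpace (Gqs L v ⧸ Subgroup.center (Gqs L v))]
    {H : Type} [Group H] [TopologicalSpace H] [IsTopologicalGroup H] [MeasurableSpace H]
    (νQv : Measure (Gqs L v)) [νQv.IsHaarMeasure] [νQv.IsMulRightInvariant]
    (mQv : OrbitalMeasureFamily (Gqs L v))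
    (hcanQ : mQv.IsCanonical (fun γ => IsRegularElt (γ.val : GL (Fin 3) (UnitaryGroup.LocalRing L v))) νQv)
    (𝔇 : EllipticData (Gqs L v) H)
    -- ══ COMPAT (two of the seven clauses of the (S-𝔇) package) ══
    (hμG : 𝔇.μG = νQv)
    (hreg : ∀ γ : Gqs L v, γ ∈ 𝔇.regG ↔ IsRegularElt (γ.val : GL (Fin 3) (UnitaryGroup.LocalRing L v)))
    -- ══ the elliptic set sits inside `G^r ∖ Ω` and `G^r ∖ Ω` is open ══
    (hEΩ : ∀ γ ∈ 𝔇.ellG, IsRegularElt (γ.val : GL (Fin 3) (UnitaryGroup.LocalRing L v)) ∧ γ ∉ hyperbolicSet L v)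
    (hopen : IsOpen {g : Gqs L v | IsRegularElt (g.val : GL (Fin 3) (UnitaryGroup.LocalRing L v)) ∧ g ∉ hyperbolicSet L v})
    -- ══ (M1∀): Harish-Chandra regularity of `χ_π` for EVERY class ══
    (hM1 : ∀ π : IrrClass (Gqs L v), Measurable (𝔇.char π) ∧ LocallyIntegrable (𝔇.char π) 𝔇.μG ∧
      (∀ x ∈ 𝔇.regG, ∀ᶠ y in 𝓝 x, 𝔇.char π y = 𝔇.char π x) ∧
      ∀ φ : Gqs L v → ℂ, IsLocSmooth φ → π.smoothTrace 𝔇.μG φ = ∫ x, φ x * 𝔇.char π x ∂𝔇.μG)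
    -- ══ the PAIR sockets (PS2), (NONL2-PAR) of the package, VERBATIM ══
    (par : IrrClass (Gqs L v) → (((UnitaryGroup.LocalRing L v)ˣ →* ℂˣ) × (↥(normOneUnits (conjLocal L (IsCMField.complexConj L) v)) →* ℂˣ)))
    (hPS2 : ∀ π σ : IrrClass (Gqs L v), ¬ 𝔇.IsL2 π → 𝔇.IsL2 σ → 𝔇.IsEllipticPair π σ → ∀ f : Gqs L v → ℂ, IsLocSmooth f →
        π.smoothTrace νQv f + σ.smoothTrace νQv f = Representation.smoothTrace (G := Gqs L v) (UnitaryGroup.cmPrincipalSeries L 3 v (UnitaryGroup.cmTorusCharPair L v (par π).1 (par π).2)) νQv f)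
    (hNP : ∀ π : IrrClass (Gqs L v), ¬ 𝔇.IsL2 π →
        π.IsConstituentOf (UnitaryGroup.cmPrincipalSeries L 3 v (UnitaryGroup.cmTorusCharPair L v (par π).1 (par π).2)) ∧
          Continuous (par π).1 ∧ Continuous (par π).2) :
    ∀ π σ : IrrClass (Gqs L v), ¬ 𝔇.IsL2 π → 𝔇.IsL2 σ → 𝔇.IsEllipticPair π σ → ∀ γ ∈ 𝔇.ellG, 𝔇.char σ γ = -𝔇.char π γ := by
  intro π σ hπ hσ hpair γ hγ
  obtain ⟨hγreg, hγΩ⟩ := hEΩ γ hγ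
  have hγR : γ ∈ 𝔇.regG := (hreg γ).2 hγreg
  -- (M1∀) for the two members
  obtain ⟨-, -, hlc₁, htr₁⟩ := hM1 π
  obtain ⟨-, -, hlc₂, htr₂⟩ := hM1 σ
  -- a compact-open `U ∋ γ` inside `G^r ∖ Ω` on which both characters are constant
  have hW : ({g : Gqs L v | IsRegularElt (g.val : GL (Fin 3) (UnitaryGroup.LocalRing L v)) ∧ g ∉ hyperbolicSet L v} ∩
      ({y | 𝔇.char π y = 𝔇.char π γ} ∩ {y | 𝔇.char σ y = 𝔇.char σ γ})) ∈ 𝓝 γ :=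
    inter_mem (hopen.mem_nhds ⟨hγreg, hγΩ⟩) (inter_mem (hlc₁ γ hγR) (hlc₂ γ hγR))
  haveI : TotallyDisconnectedSpace (Gqs L v) := totallyDisconnectedSpace_cmDatum_local L 3 (qsForm L) v
  obtain ⟨O, hOW, hOo, hγO⟩ := mem_nhds_iff.1 hW
  obtain ⟨U, hUc, hUo, hγU, hUO⟩ := Literature.Topology.exists_isCompact_isOpen_mem_subset hOo hγO
  have hUW : U ⊆ _ := hUO.trans hOW
  have hφ : IsLocSmooth (U.indicator fun _ => (1 : ℂ)) := isLocSmooth_indicator hUo hUc.isClosed hUc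
  -- `Tr τ(𝟙_U) = ν(U)·χ_τ(γ)` for `τ = π, σ`
  have hT : ∀ {τ : IrrClass (Gqs L v)}, (∀ φ : Gqs L v → ℂ, IsLocSmooth φ → τ.smoothTrace 𝔇.μG φ = ∫ x, φ x * 𝔇.char τ x ∂𝔇.μG) →
      (∀ g ∈ U, 𝔇.char τ g = 𝔇.char τ γ) → τ.smoothTrace νQv (U.indicator fun _ => (1 : ℂ)) = (νQv.real U : ℂ) * 𝔇.char τ γ := by
    intro τ htr hcst
    rw [← hμG, htr _ hφ, hμG]
    exact F0P3cStCharTSCasselmanCap.integral_indicator_mul_eq_of_eqOn νQv hUo.measurableSet _ γ hcst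
  have h1 : π.smoothTrace νQv (U.indicator fun _ => (1 : ℂ)) = (νQv.real U : ℂ) * 𝔇.char π γ := hT htr₁ fun g hg => (hUW hg).2.1
  have h2 : σ.smoothTrace νQv (U.indicator fun _ => (1 : ℂ)) = (νQv.real U : ℂ) * 𝔇.char σ γ := hT htr₂ fun g hg => (hUW hg).2.2
  -- `Tr i_G(par π)(𝟙_U) = 0`: the orbital integrals of `𝟙_U` vanish at the regular split classes (`U ∩ Ω = ∅`)
  obtain ⟨-, hc1, hc2⟩ := hNP π hπ
  have h0 : Representation.smoothTrace (G := Gqs L v)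
      (UnitaryGroup.cmPrincipalSeries L 3 v (UnitaryGroup.cmTorusCharPair L v (par π).1 (par π).2)) νQv (U.indicator fun _ => (1 : ℂ)) = 0 :=
    psTrace_eq_zero_of_forall_classOrbitalIntegral_split_eq_zero L v hns νQv mQv hcanQ _ hφ
      (fun t ht => classOrbitalIntegral_indicator_eq_zero_of_disjoint_hyperbolicSet L v mQv (fun g hg => (hUW hg).1.2) t ht) (par π) hc1 hc2
  -- (PS2) at `𝟙_U`
  have hid := hPS2 π σ hπ hσ hpair _ hφ
  rw [h1, h2, h0, ← mul_add, mul_eq_zero] at hid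
  -- `ν(U) > 0`
  have hpos : (νQv.real U : ℂ) ≠ 0 := by
    have hp : 0 < νQv.real U :=
      ENNReal.toReal_pos (hUo.measure_pos νQv ⟨γ, hγU⟩).ne' hUc.measure_lt_top.ne
    exact_mod_cast hp.ne'
  exact eq_neg_of_add_eq_zero_right (hid.resolve_left hpos)

/-! ## §2 The symmetric orientation -/

set_option maxHeartbeats 1600000 in
set_option synthInstance.maxHeartbeats 400000 in
/-- **«OPP-23★», symmetric orientation**: under the hypotheses of `charOpposite_of_PS2`, `χ_π = −χ_σ` on `G^e` for `π` non-square-integrable, `σ` square-integrable,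
`{π, σ}` a pair of one of the three kinds. [cite: Rogawski1990, §12.6 Prop. 12.6.1 (c) p. 188; §12.7 L. 12.7.2 (proof) p. 192] -/
theorem charOpposite_of_PS2'
    (L : Type) [Field L] [NumberField L] [IsCMField L] (v : HeightOneSpectrum (𝓞 ↥(maximalRealSubfield L)))
    (hns : ∀ w : PlacesOver L v, IsCMField.complexConj L • w.1 = w.1)
    [MeasurableSpace (Gqs L v)] [BorelSpace (Gqs L v)]
    [∀ γ : Gqs L v, MeasurableSpace (Gqs L v ⧸ Subgroup.centralizer ({γ} : Set (Gqs L v)))]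
    [∀ γ : Gqs L v, BorelSpace (Gqs L v ⧸ Subgroup.centralizer ({γ} : Set (Gqs L v)))]
    [MeasurableSpace (Gqs L v ⧸ Subgroup.center (Gqs L v))]
    {H : Type} [Group H] [TopologicalSpace H] [IsTopologicalGroup H] [MeasurableSpace H]
    (νQv : Measure (Gqs L v)) [νQv.IsHaarMeasure] [νQv.IsMulRightInvariant]
    (mQv : OrbitalMeasureFamily (Gqs L v))
    (hcanQ : mQv.IsCanonical (fun γ => IsRegularElt (γ.val : GL (Fin 3) (UnitaryGroup.LocalRing L v))) νQv)
    (𝔇 : EllipticData (Gqs L v) H)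
    (hμG : 𝔇.μG = νQv)
    (hreg : ∀ γ : Gqs L v, γ ∈ 𝔇.regG ↔ IsRegularElt (γ.val : GL (Fin 3) (UnitaryGroup.LocalRing L v)))
    (hEΩ : ∀ γ ∈ 𝔇.ellG, IsRegularElt (γ.val : GL (Fin 3) (UnitaryGroup.LocalRing L v)) ∧ γ ∉ hyperbolicSet L v)
    (hopen : IsOpen {g : Gqs L v | IsRegularElt (g.val : GL (Fin 3) (UnitaryGroup.LocalRing L v)) ∧ g ∉ hyperbolicSet L v})
    (hM1 : ∀ π : IrrClass (Gqs L v), Measurable (𝔇.char π) ∧ LocallyIntegrable (𝔇.char π) 𝔇.μG ∧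
      (∀ x ∈ 𝔇.regG, ∀ᶠ y in 𝓝 x, 𝔇.char π y = 𝔇.char π x) ∧
      ∀ φ : Gqs L v → ℂ, IsLocSmooth φ → π.smoothTrace 𝔇.μG φ = ∫ x, φ x * 𝔇.char π x ∂𝔇.μG)
    (par : IrrClass (Gqs L v) → (((UnitaryGroup.LocalRing L v)ˣ →* ℂˣ) × (↥(normOneUnits (conjLocal L (IsCMField.complexConj L) v)) →* ℂˣ)))
    (hPS2 : ∀ π σ : IrrClass (Gqs L v), ¬ 𝔇.IsL2 π → 𝔇.IsL2 σ → 𝔇.IsEllipticPair π σ → ∀ f : Gqs L v → ℂ, IsLocSmooth f →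
        π.smoothTrace νQv f + σ.smoothTrace νQv f = Representation.smoothTrace (G := Gqs L v) (UnitaryGroup.cmPrincipalSeries L 3 v (UnitaryGroup.cmTorusCharPair L v (par π).1 (par π).2)) νQv f)
    (hNP : ∀ π : IrrClass (Gqs L v), ¬ 𝔇.IsL2 π →
        π.IsConstituentOf (UnitaryGroup.cmPrincipalSeries L 3 v (UnitaryGroup.cmTorusCharPair L v (par π).1 (par π).2)) ∧
          Continuous (par π).1 ∧ Continuous (par π).2) :
    ∀ π σ : IrrClass (Gqs L v), ¬ 𝔇.IsL2 π → 𝔇.IsL2 σ → 𝔇.IsEllipticPair π σ → ∀ γ ∈ 𝔇.ellG, 𝔇.char π γ = -𝔇.char σ γ := by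
  intro π σ hπ hσ hpair γ hγ
  rw [charOpposite_of_PS2 L v hns νQv mQv hcanQ 𝔇 hμG hreg hEΩ hopen hM1 par hPS2 hNP π σ hπ hσ hpair γ hγ, neg_neg]

end Summit.HodgeConjecture.HodgeConjecture.Cruxes.H413.F0P3cStCharTSOpp23

end
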